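import Summits.QuantumFields.YangMills.Theorems.UnitScaleTiltProp7CovPinJunkSums
import Summits.QuantumFields.YangMills.Theorems.UnitScaleTiltProp7CovPinCharge
import HarnessLib

/-!
# Route `UnitScaleTilt`, crux K1 «MinimiserStabilityRegPr» (stmt-QuantumFields-19200), route-R E′ path (α′), (E1-b) covariant, row (hK₂-cov) — FILE F4a-cov «JUNK-Φ»:
# THE FRAME-JUNK `L¹` SUM AT A PIN — `J₁ = Σ_{0<s≤m}‖Δ₁v‖` for the framed field `v = R(Fr⁻¹)V`
# of a matrix field `V` COVARIANTLY HARMONIC ON THE PUNCTURED BALL `{0 < s ≤ 2m}`, in terms of `τ₁, τ₂` and ONE mass `𝓜 = Σ_{s ≤ 2m+1} hs V` (`s = tdist(·,y)`, d = 3)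

Cell `ym3-torus`, width seat `ym3-torus-px11` (gen 3), LEAD of the (hK₂-cov) chain (routeR-w3 g6 WORDS (8)–(10)); LOCATE 19200 evidence #57 `LOCATE-HK2COV-px11g3.md` §1 rows (Q)(PIN), §2.
`--kind proof --supports stmt-QuantumFields-19200 --as helper`, count-neutral.  THEOREMS ONLY (0 `def`, 0 `sorry`).  YM₃ on T³ is a ladder rung (R3) — not d = 4, not infinite
volume, not a mass gap, not the Clay problem; nothing here claims the stub, the crux or the gap.

THE POINT (numbers).  F3c ✓p675494 reduces the near row to `J₁, J₂, ‖Δ₁v(y)‖` of the framed field; F3a ✓p674600 bounds `‖Δ₁v(z)‖` off the pin by the FRAME-FREE majorant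
`Φ(z) = Σ_μ[2τ₁(‖D_UV(z,μ)‖ + ‖D_UV(z−e_μ,μ)‖ + 2τ₁(‖V(z+e_μ)‖ + ‖V z‖)) + (2τ₂+4τ₁²)‖V(z−e_μ)‖]`; this file sums `Φ` and `s²Φ²` over the punctured ball `{0 < s ≤ m}` with the
`s²`-weighted gradient energy ∕ `L¹` gradient mass of F3d ✓p674979 — run with the tent of outer radius `2m` (`R+1 = m`), which stays INSIDE the punctured harmonic ball
`{0 < s ≤ 2m}` (at the member `ℓ = L^k = 2m+1` is odd and the nearest other centre is at `s = ℓ`); the one-step spill `s ≤ m+1` of the `D_UV(z−e_μ,μ)`-terms is covered by the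
same tent through `s ≤ 2ψ` on `s ≤ m+1` (`m ≥ 3`).  Outcome: `J₁ ≲ (τ₁√m + (τ₂+τ₁²)m^{3∕2})·√𝓜` and `J₂ ≲ (τ₁² + m²(τ₂+τ₁²)²)·𝓜` — with `τ₁ ≍ e∕ℓ`, `τ₂ ≍ e∕ℓ²`, `𝓜 ≍ ℓ³M²`:
`J₁ ≍ eℓM`, `√(ℓJ₂) ≍ eℓM` — the RIGHT powers (LOCATE #57 §2).

WHAT IS PROVED (ns `…Theorems.Prop7CovPinJunkPhi`; torus `Site P i` (`P.d = 3` where stated), unitary + bi-contractive `U`, bi-contractive `Fr`, pin `y`, `m ≥ 3`;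
`V` with `Δ_UV = 0` on `{0 < s ≤ 2m}`; `𝓜 := Σ_{s ≤ 2m+1} hs V`; frame rows `τ₁` on `{s ≤ m+1}`, `τ₂` on the backward differences at `{s ≤ m}`).
* §1 energy∕mass letters: `sq_le_four_tent_sq`, ★ `sum_punctured_sq_hs_covD_le'` (inner radius `R+2`, factor 4), `sum_norm_le_of_energy` (CS device),
  ★ `sum_punctured_norm_covD_le'`, `norm_le_sqrt_mass`, `norm_covD_le_add`, `sum_norm_le_sqrt_card_mass`.
* §2 reindexing letters: `tdist_unshift_le_succ`, `sum_unshift_le`, `sum_shift_le`, `sum_punctured_le_ball`, `sum_ball_le_centre_add`.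
* §3 ★★★ `J1_le` — `Σ_{0<s≤m}‖Δ₁v z‖ ≤ 4τ₁·√(576(m+1))·√(36d·𝓜) + 12τ₁·√𝓜 + (36τ₁² + 6τ₂)·√((2(m+2))³)·√𝓜`.
HONEST SCOPE.  Bookkeeping with generous absolute constants; nothing of Bałaban's is asserted.  `J₂` and the charge comparison (same letters) are the sibling file
`…CovPinJunkPhiSq`; F4b-cov (far + near ⇒ `min(δ,ℓ)·‖V x‖ ≤ C·ℓ·M`) is the sequel.

References: M. Giaquinta, Princeton UP 1983 [Giaquinta1984] (Ch. III §1); T. Bałaban, CMP 99 (1985) 389–434 [Balaban1985BackgroundPropagators] ((3.8) p.392, (3.35) p.396).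
-/

set_option autoImplicit false

noncomputable section

open scoped BigOperators Matrix.Norms.L2Operator Matrix

namespace Summit.QuantumFields.YangMills.Theorems.Prop7CovPinJunkPhi

open Literature.MathematicalPhysics.QuantumFieldTheory.Balaban1983to89
open Finset
open LatticeFieldCalculus (laplace)
open B9Eq39Adjoint (R covD divB)
open B9Eq310Hermitian (norm_R_le)
open B9TorusCalculus (torusT torusT_apply)
open B3Taylor310LocalRemainder (tdist_comm tdist_self tdist_triangle)
open Summit.QuantumFields.YangMills.Theorems.Prop7CovPuncturedCaccioppoli (hs_covD_le)
open Summit.QuantumFields.YangMills.Theorems.Prop7CovPinJunkSums (tdist_shift_le_succ tdist_le_tdist_shift_succ tent_eq_of_le tent_ne_zero sum_tent_sq_hs_covD_le norm_le_sqrt_hs)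
open Summit.QuantumFields.YangMills.Theorems.Prop7InterpErrorPinAbstract (tdist_pos_of_ne)
open Summit.QuantumFields.YangMills.Theorems.Prop7TorusRadialSums (card_ball_le_real sum_inv_tdist_sq_le)
open Summit.QuantumFields.YangMills.Theorems.Prop7CovPinCharge (norm_framed_eq norm_framed_fdiff_le framedLink_bicontr norm_laplace_one_framed_le)
open Summit.QuantumFields.YangMills.Theorems.Prop7FramedCovLaplacian (R_inv_frame_covLaplace norm_covLaplace_sub_laplace_one_le_T)
open Summit.QuantumFields.YangMills.Theorems.Prop7PinnedSupOfGradient (norm_R_eq)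

variable {P : Params} {i : ℕ} {N : ℕ}

/-! ## §1 Energy and mass letters -/

section Energy

variable {U : Fin P.d → Site P i → (Matrix (Fin N) (Fin N) ℂ)ˣ}

omit U in
/-- On `1 ≤ s ≤ R+2` with `R ≥ 2` the distance is at most twice the tent: `s² ≤ 4·ψ(s)²`, `ψ = max 0 (min s (2(R+1) − s))`. [folklore] -/
theorem sq_le_four_tent_sq {s R : ℕ} (hR : 2 ≤ R) (hs : s ≤ R + 2) :
    ((s : ℕ) : ℝ) ^ 2 ≤ 4 * (max 0 (min ((s : ℕ) : ℝ) (2 * ((R : ℝ) + 1) - ((s : ℕ) : ℝ)))) ^ 2 := by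
  have hs' : (s : ℝ) ≤ (R : ℝ) + 2 := by exact_mod_cast hs
  have hR' : (2 : ℝ) ≤ R := by exact_mod_cast hR
  have h0 : (0 : ℝ) ≤ s := Nat.cast_nonneg _
  have hmin : (s : ℝ) / 2 ≤ min ((s : ℕ) : ℝ) (2 * ((R : ℝ) + 1) - ((s : ℕ) : ℝ)) := by
    refine le_min (by linarith) (by linarith)
  have hmax : (s : ℝ) / 2 ≤ max 0 (min ((s : ℕ) : ℝ) (2 * ((R : ℝ) + 1) - ((s : ℕ) : ℝ))) := hmin.trans (le_max_right _ _)
  nlinarith [hmax, h0]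

/-- ★ **`s²`-WEIGHTED GRADIENT ENERGY WITH ONE-STEP SPILL**: `V` covariantly harmonic on `{0 < s ≤ 2R+2}`, `R ≥ 2` ⇒
`Σ_{1 ≤ s ≤ R+2} s²·Σ_μ hs(D_μV z) ≤ 36d·Σ_{s ≤ 2R+3} hs V` (the tent of ✓ `sum_tent_sq_hs_covD_le`, `s² ≤ 4ψ²` on `s ≤ R+2`). [folklore] [cite: Giaquinta1984, Ch. III §1 Thm 1.2 p.70] -/
theorem sum_punctured_sq_hs_covD_le' (hU : ∀ ν x, (U ν x : Matrix (Fin N) (Fin N) ℂ) ∈ unitary (Matrix (Fin N) (Fin N) ℂ))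
    (V : Site P i → Matrix (Fin N) (Fin N) ℂ) (y : Site P i) {R : ℕ} (hR : 2 ≤ R)
    (hV : ∀ z, 0 < Site.tdist z y → Site.tdist z y ≤ 2 * R + 2 → divB (torusT P i) U (fun μ => covD (torusT P i) U μ V) z = 0) :
    ∑ z ∈ Finset.univ.filter (fun z : Site P i => 1 ≤ Site.tdist z y ∧ Site.tdist z y ≤ R + 2), ∑ μ : Fin P.d,
        ((Site.tdist z y : ℕ) : ℝ) ^ 2 * ∑ j : Fin N, ∑ k : Fin N, ‖(covD (torusT P i) U μ V z) j k‖ ^ 2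
      ≤ 36 * P.d * ∑ z ∈ Finset.univ.filter (fun z : Site P i => Site.tdist z y ≤ 2 * R + 3), ∑ j : Fin N, ∑ k : Fin N, ‖(V z) j k‖ ^ 2 := by
  classical
  have h := sum_tent_sq_hs_covD_le hU V y R hV
  have hnn : ∀ z ∈ (Finset.univ : Finset (Site P i)), z ∉ Finset.univ.filter (fun z : Site P i => 1 ≤ Site.tdist z y ∧ Site.tdist z y ≤ R + 2) →
      0 ≤ ∑ μ : Fin P.d, 4 * (max 0 (min ((Site.tdist z y : ℕ) : ℝ) (2 * ((R : ℝ) + 1) - ((Site.tdist z y : ℕ) : ℝ)))) ^ 2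
          * ∑ j : Fin N, ∑ k : Fin N, ‖(covD (torusT P i) U μ V z) j k‖ ^ 2 :=
    fun z _ _ => Finset.sum_nonneg fun μ _ => mul_nonneg (by positivity) (Finset.sum_nonneg fun _ _ => Finset.sum_nonneg fun _ _ => sq_nonneg _)
  calc _ ≤ ∑ z ∈ Finset.univ.filter (fun z : Site P i => 1 ≤ Site.tdist z y ∧ Site.tdist z y ≤ R + 2), ∑ μ : Fin P.d,
          4 * (max 0 (min ((Site.tdist z y : ℕ) : ℝ) (2 * ((R : ℝ) + 1) - ((Site.tdist z y : ℕ) : ℝ)))) ^ 2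
            * ∑ j : Fin N, ∑ k : Fin N, ‖(covD (torusT P i) U μ V z) j k‖ ^ 2 := by
        refine Finset.sum_le_sum fun z hz => Finset.sum_le_sum fun μ _ => ?_
        rw [Finset.mem_filter] at hz
        exact mul_le_mul_of_nonneg_right (sq_le_four_tent_sq hR hz.2.2) (Finset.sum_nonneg fun _ _ => Finset.sum_nonneg fun _ _ => sq_nonneg _)
    _ ≤ ∑ z : Site P i, ∑ μ : Fin P.d, 4 * (max 0 (min ((Site.tdist z y : ℕ) : ℝ) (2 * ((R : ℝ) + 1) - ((Site.tdist z y : ℕ) : ℝ)))) ^ 2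
            * ∑ j : Fin N, ∑ k : Fin N, ‖(covD (torusT P i) U μ V z) j k‖ ^ 2 :=
        Finset.sum_le_sum_of_subset_of_nonneg (Finset.subset_univ _) hnn
    _ = 4 * ∑ z : Site P i, ∑ μ : Fin P.d, (max 0 (min ((Site.tdist z y : ℕ) : ℝ) (2 * ((R : ℝ) + 1) - ((Site.tdist z y : ℕ) : ℝ)))) ^ 2
            * ∑ j : Fin N, ∑ k : Fin N, ‖(covD (torusT P i) U μ V z) j k‖ ^ 2 := by
        rw [Finset.mul_sum]; refine Finset.sum_congr rfl fun z _ => ?_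
        rw [Finset.mul_sum]; refine Finset.sum_congr rfl fun μ _ => ?_
        ring
    _ ≤ 4 * (9 * P.d * ∑ z ∈ Finset.univ.filter (fun z : Site P i => Site.tdist z y ≤ 2 * R + 3), ∑ j : Fin N, ∑ k : Fin N, ‖(V z) j k‖ ^ 2) := by linarith
    _ = _ := by ring

omit U in
/-- **CAUCHY–SCHWARZ DEVICE** (`d = 3`): if `S ⊆ {1 ≤ s ≤ Nn}` and `Σ_{S}Σ_μ s²·hs(A_μ z) ≤ E`, then `Σ_{S}Σ_μ ‖A_μ z‖ ≤ √(576·Nn)·√E` (op norm ≤ HS norm, CS over `(z,μ)`,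
`Σ_{S} s⁻² ≤ 192·Nn` ✓ `sum_inv_tdist_sq_le`). [folklore] -/
theorem sum_norm_le_of_energy (hd : P.d = 3) (y : Site P i) (S : Finset (Site P i)) {Nn : ℕ} (hNn : 1 ≤ Nn)
    (hS : ∀ z ∈ S, 1 ≤ Site.tdist z y ∧ Site.tdist z y ≤ Nn) (A : Fin P.d → Site P i → Matrix (Fin N) (Fin N) ℂ) {E : ℝ}
    (hE : ∑ z ∈ S, ∑ μ : Fin P.d, ((Site.tdist z y : ℕ) : ℝ) ^ 2 * ∑ j : Fin N, ∑ k : Fin N, ‖(A μ z) j k‖ ^ 2 ≤ E) :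
    ∑ z ∈ S, ∑ μ : Fin P.d, ‖A μ z‖ ≤ Real.sqrt (576 * (Nn : ℝ)) * Real.sqrt E := by
  classical
  set a : Site P i × Fin P.d → ℝ := fun p => ((Site.tdist p.1 y : ℕ) : ℝ)⁻¹ with ha
  set b : Site P i × Fin P.d → ℝ := fun p => ((Site.tdist p.1 y : ℕ) : ℝ) * Real.sqrt (∑ j : Fin N, ∑ k : Fin N, ‖(A p.2 p.1) j k‖ ^ 2) with hb
  have hpt : ∀ z ∈ S, ∀ μ : Fin P.d, ‖A μ z‖ ≤ a (z, μ) * b (z, μ) := by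
    intro z hz μ
    have hs : (0 : ℝ) < ((Site.tdist z y : ℕ) : ℝ) := by exact_mod_cast (hS z hz).1
    rw [ha, hb]; dsimp only
    rw [← mul_assoc, inv_mul_cancel₀ hs.ne', one_mul]
    exact norm_le_sqrt_hs _
  have h1 : ∑ z ∈ S, ∑ μ : Fin P.d, ‖A μ z‖ ≤ ∑ p ∈ S ×ˢ (Finset.univ : Finset (Fin P.d)), a p * b p := by
    rw [Finset.sum_product]; exact Finset.sum_le_sum fun z hz => Finset.sum_le_sum fun μ _ => hpt z hz μ
  have h2 := Real.sum_mul_le_sqrt_mul_sqrt (S ×ˢ (Finset.univ : Finset (Fin P.d))) a b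
  have ha2 : ∑ p ∈ S ×ˢ (Finset.univ : Finset (Fin P.d)), a p ^ 2 ≤ 576 * (Nn : ℝ) := by
    rw [Finset.sum_product]
    have hrad := sum_inv_tdist_sq_le hd S y (M := 1) (N := Nn) le_rfl hNn hS
    calc ∑ z ∈ S, ∑ _μ : Fin P.d, a (z, _μ) ^ 2 = ∑ z ∈ S, (P.d : ℝ) * ((((Site.tdist z y : ℕ) : ℝ)) ^ 2)⁻¹ := by
          refine Finset.sum_congr rfl fun z _ => ?_
          simp only [ha, Finset.sum_const, Finset.card_univ, Fintype.card_fin, nsmul_eq_mul, inv_pow]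
      _ = (P.d : ℝ) * ∑ z ∈ S, ((((Site.tdist z y : ℕ) : ℝ)) ^ 2)⁻¹ := by rw [Finset.mul_sum]
      _ ≤ 3 * (192 * (Nn : ℝ)) := by
          rw [hd]; push_cast
          exact mul_le_mul_of_nonneg_left (by exact_mod_cast hrad) (by norm_num)
      _ = 576 * (Nn : ℝ) := by ring
  have hb2 : ∑ p ∈ S ×ˢ (Finset.univ : Finset (Fin P.d)), b p ^ 2 ≤ E := by
    rw [Finset.sum_product]
    refine le_trans (le_of_eq ?_) hE
    refine Finset.sum_congr rfl fun z _ => Finset.sum_congr rfl fun μ _ => ?_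
    rw [hb]; dsimp only
    rw [mul_pow, Real.sq_sqrt (Finset.sum_nonneg fun _ _ => Finset.sum_nonneg fun _ _ => sq_nonneg _)]
  calc _ ≤ _ := h1
    _ ≤ _ := h2
    _ ≤ Real.sqrt (576 * (Nn : ℝ)) * Real.sqrt E := mul_le_mul (Real.sqrt_le_sqrt ha2) (Real.sqrt_le_sqrt hb2) (Real.sqrt_nonneg _) (Real.sqrt_nonneg _)

/-- ★ **`L¹` GRADIENT MASS WITH ONE-STEP SPILL** (`d = 3`, `R ≥ 2`): `Σ_{1≤s≤R+2} Σ_μ ‖D_μV z‖ ≤ √(576(R+2))·√(36d·Σ_{s≤2R+3} hs V)`. [folklore] -/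
theorem sum_punctured_norm_covD_le' (hd : P.d = 3) (hU : ∀ ν x, (U ν x : Matrix (Fin N) (Fin N) ℂ) ∈ unitary (Matrix (Fin N) (Fin N) ℂ))
    (V : Site P i → Matrix (Fin N) (Fin N) ℂ) (y : Site P i) {R : ℕ} (hR : 2 ≤ R)
    (hV : ∀ z, 0 < Site.tdist z y → Site.tdist z y ≤ 2 * R + 2 → divB (torusT P i) U (fun μ => covD (torusT P i) U μ V) z = 0) :
    ∑ z ∈ Finset.univ.filter (fun z : Site P i => 1 ≤ Site.tdist z y ∧ Site.tdist z y ≤ R + 2), ∑ μ : Fin P.d, ‖covD (torusT P i) U μ V z‖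
      ≤ Real.sqrt (576 * ((R + 2 : ℕ) : ℝ))
        * Real.sqrt (36 * P.d * ∑ z ∈ Finset.univ.filter (fun z : Site P i => Site.tdist z y ≤ 2 * R + 3), ∑ j : Fin N, ∑ k : Fin N, ‖(V z) j k‖ ^ 2) := by
  classical
  exact sum_norm_le_of_energy hd y _ (Nn := R + 2) (by omega) (fun z hz => by rw [Finset.mem_filter] at hz; exact hz.2)
    (fun μ z => covD (torusT P i) U μ V z) (sum_punctured_sq_hs_covD_le' hU V y hR hV)

omit U in
/-- Pointwise mass: `tdist(z,y) ≤ t ⇒ ‖V z‖ ≤ √(Σ_{s ≤ t} hs V)` (`‖X‖² ≤ hs X`, one term of the sum). [folklore] -/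
theorem norm_le_sqrt_mass (V : Site P i → Matrix (Fin N) (Fin N) ℂ) (y : Site P i) (t : ℕ) (z : Site P i) (hz : Site.tdist z y ≤ t) :
    ‖V z‖ ≤ Real.sqrt (∑ w ∈ Finset.univ.filter (fun w : Site P i => Site.tdist w y ≤ t), ∑ j : Fin N, ∑ k : Fin N, ‖(V w) j k‖ ^ 2) := by
  classical
  refine (norm_le_sqrt_hs (V z)).trans (Real.sqrt_le_sqrt ?_)
  have hzmem : z ∈ Finset.univ.filter (fun w : Site P i => Site.tdist w y ≤ t) := by
    rw [Finset.mem_filter]; exact ⟨Finset.mem_univ _, hz⟩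
  exact Finset.single_le_sum (f := fun w => ∑ j : Fin N, ∑ k : Fin N, ‖(V w) j k‖ ^ 2)
    (fun _ _ => Finset.sum_nonneg fun _ _ => Finset.sum_nonneg fun _ _ => sq_nonneg _) hzmem

/-- At the pin: `‖(D_μV)(y)‖ ≤ ‖V(y+e_μ)‖ + ‖V y‖` (bi-contractive `U`). [cite: Balaban1985BackgroundPropagators, (3.3) p.390] -/
theorem norm_covD_le_add (hUb : ∀ (κ : Fin P.d) (w : Site P i), ‖(U κ w : Matrix (Fin N) (Fin N) ℂ)‖ ≤ 1 ∧ ‖(((U κ w)⁻¹ : (Matrix (Fin N) (Fin N) ℂ)ˣ) : Matrix (Fin N) (Fin N) ℂ)‖ ≤ 1)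
    (V : Site P i → Matrix (Fin N) (Fin N) ℂ) (μ : Fin P.d) (z : Site P i) :
    ‖covD (torusT P i) U μ V z‖ ≤ ‖V (z.shift μ)‖ + ‖V z‖ := by
  simp only [covD, torusT_apply]
  exact (norm_sub_le _ _).trans (add_le_add (norm_R_le (hUb μ z).1 (hUb μ z).2 _) le_rfl)

omit U in
/-- `Σ_{s ≤ t} ‖V‖ ≤ √((2(t+1))³)·√(Σ_{s ≤ t'} hs V)` for `t ≤ t'` (`d = 3`; Cauchy–Schwarz + ball count ✓ `card_ball_le_real`). [folklore] -/
theorem sum_norm_le_sqrt_card_mass (hd : P.d = 3) (V : Site P i → Matrix (Fin N) (Fin N) ℂ) (y : Site P i) {t t' : ℕ} (htt : t ≤ t') :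
    ∑ z ∈ Finset.univ.filter (fun z : Site P i => Site.tdist z y ≤ t), ‖V z‖
      ≤ Real.sqrt ((2 * ((t : ℝ) + 1)) ^ 3) * Real.sqrt (∑ w ∈ Finset.univ.filter (fun w : Site P i => Site.tdist w y ≤ t'), ∑ j : Fin N, ∑ k : Fin N, ‖(V w) j k‖ ^ 2) := by
  classical
  set S := Finset.univ.filter (fun z : Site P i => Site.tdist z y ≤ t) with hSdef
  have h1 := Real.sum_mul_le_sqrt_mul_sqrt S (fun _ => (1 : ℝ)) (fun z => ‖V z‖)
  simp only [one_mul, one_pow, Finset.sum_const, nsmul_eq_mul, mul_one] at h1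
  have hcard : ((S.card : ℕ) : ℝ) ≤ (2 * ((t : ℝ) + 1)) ^ 3 := by
    have h := card_ball_le_real (P := P) (j := i) y t
    rw [hd] at h; exact h
  have hsq : ∑ z ∈ S, ‖V z‖ ^ 2 ≤ ∑ w ∈ Finset.univ.filter (fun w : Site P i => Site.tdist w y ≤ t'), ∑ j : Fin N, ∑ k : Fin N, ‖(V w) j k‖ ^ 2 := by
    calc ∑ z ∈ S, ‖V z‖ ^ 2 ≤ ∑ z ∈ S, ∑ j : Fin N, ∑ k : Fin N, ‖(V z) j k‖ ^ 2 :=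
          Finset.sum_le_sum fun z _ => MatrixNorms.opNorm_sq_le_sum_norm_sq (V z)
      _ ≤ _ := by
          refine Finset.sum_le_sum_of_subset_of_nonneg (fun z hz => ?_) fun _ _ _ => Finset.sum_nonneg fun _ _ => Finset.sum_nonneg fun _ _ => sq_nonneg _
          rw [hSdef, Finset.mem_filter] at hz
          rw [Finset.mem_filter]; exact ⟨hz.1, hz.2.trans htt⟩
  calc ∑ z ∈ S, ‖V z‖ ≤ Real.sqrt (S.card : ℝ) * Real.sqrt (∑ z ∈ S, ‖V z‖ ^ 2) := h1
    _ ≤ _ := mul_le_mul (Real.sqrt_le_sqrt hcard) (Real.sqrt_le_sqrt hsq) (Real.sqrt_nonneg _) (Real.sqrt_nonneg _)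

end Energy

/-! ## §2 Reindexing letters around the pin -/

section Reindex

/-- `tdist(z−e_μ, y) ≤ tdist(z, y) + 1`. [folklore] -/
theorem tdist_unshift_le_succ (z y : Site P i) (μ : Fin P.d) : Site.tdist (z.unshift μ) y ≤ Site.tdist z y + 1 := by
  have h := tdist_le_tdist_shift_succ (z.unshift μ) y μ
  rwa [Site.shift_unshift] at h

/-- Shifting the punctured inner ball backwards lands in the next ball: `Σ_{1≤s≤m} f(z−e_μ) ≤ Σ_{s≤m+1} f` for `f ≥ 0`. [folklore] -/
theorem sum_unshift_le (y : Site P i) (m : ℕ) (μ : Fin P.d) (f : Site P i → ℝ) (hf : ∀ w, 0 ≤ f w) :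
    ∑ z ∈ Finset.univ.filter (fun z : Site P i => 1 ≤ Site.tdist z y ∧ Site.tdist z y ≤ m), f (z.unshift μ)
      ≤ ∑ w ∈ Finset.univ.filter (fun w : Site P i => Site.tdist w y ≤ m + 1), f w := by
  classical
  have hinj : Set.InjOn (fun z : Site P i => z.unshift μ) (Finset.univ.filter (fun z : Site P i => 1 ≤ Site.tdist z y ∧ Site.tdist z y ≤ m) : Finset (Site P i)) :=
    fun a _ b _ h => by simpa using congrArg (fun z : Site P i => z.shift μ) h
  rw [← Finset.sum_image (f := f) hinj]
  refine Finset.sum_le_sum_of_subset_of_nonneg (fun w hw => ?_) fun w _ _ => hf w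
  obtain ⟨z, hz, rfl⟩ := Finset.mem_image.1 hw
  rw [Finset.mem_filter] at hz ⊢
  exact ⟨Finset.mem_univ _, by have := tdist_unshift_le_succ z y μ; omega⟩

/-- … and forwards: `Σ_{1≤s≤m} f(z+e_μ) ≤ Σ_{s≤m+1} f`. [folklore] -/
theorem sum_shift_le (y : Site P i) (m : ℕ) (μ : Fin P.d) (f : Site P i → ℝ) (hf : ∀ w, 0 ≤ f w) :
    ∑ z ∈ Finset.univ.filter (fun z : Site P i => 1 ≤ Site.tdist z y ∧ Site.tdist z y ≤ m), f (z.shift μ)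
      ≤ ∑ w ∈ Finset.univ.filter (fun w : Site P i => Site.tdist w y ≤ m + 1), f w := by
  classical
  have hinj : Set.InjOn (fun z : Site P i => z.shift μ) (Finset.univ.filter (fun z : Site P i => 1 ≤ Site.tdist z y ∧ Site.tdist z y ≤ m) : Finset (Site P i)) :=
    fun a _ b _ h => by simpa using congrArg (fun z : Site P i => z.unshift μ) h
  rw [← Finset.sum_image (f := f) hinj]
  refine Finset.sum_le_sum_of_subset_of_nonneg (fun w hw => ?_) fun w _ _ => hf w
  obtain ⟨z, hz, rfl⟩ := Finset.mem_image.1 hw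
  rw [Finset.mem_filter] at hz ⊢
  exact ⟨Finset.mem_univ _, by have := tdist_shift_le_succ z y μ; omega⟩

/-- The punctured inner ball sits in the next ball: `Σ_{1≤s≤m} f ≤ Σ_{s≤m+1} f` for `f ≥ 0`. [folklore] -/
theorem sum_punctured_le_ball (y : Site P i) (m : ℕ) (f : Site P i → ℝ) (hf : ∀ w, 0 ≤ f w) :
    ∑ z ∈ Finset.univ.filter (fun z : Site P i => 1 ≤ Site.tdist z y ∧ Site.tdist z y ≤ m), f z
      ≤ ∑ w ∈ Finset.univ.filter (fun w : Site P i => Site.tdist w y ≤ m + 1), f w := by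
  classical
  refine Finset.sum_le_sum_of_subset_of_nonneg (fun w hw => ?_) fun w _ _ => hf w
  rw [Finset.mem_filter] at hw ⊢
  exact ⟨hw.1, by omega⟩

/-- Splitting off the centre: `Σ_{s≤t} f ≤ f y + Σ_{1≤s≤t} f` for `f ≥ 0` (the only site at distance `0` from `y` is `y`). [folklore] -/
theorem sum_ball_le_centre_add (y : Site P i) (t : ℕ) (f : Site P i → ℝ) (hf : ∀ w, 0 ≤ f w) :
    ∑ w ∈ Finset.univ.filter (fun w : Site P i => Site.tdist w y ≤ t), f w
      ≤ f y + ∑ w ∈ Finset.univ.filter (fun w : Site P i => 1 ≤ Site.tdist w y ∧ Site.tdist w y ≤ t), f w := by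
  classical
  have hsub : Finset.univ.filter (fun w : Site P i => Site.tdist w y ≤ t)
      ⊆ {y} ∪ Finset.univ.filter (fun w : Site P i => 1 ≤ Site.tdist w y ∧ Site.tdist w y ≤ t) := by
    intro w hw
    rw [Finset.mem_filter] at hw
    rw [Finset.mem_union, Finset.mem_singleton, Finset.mem_filter]
    by_cases hwy : w = y
    · exact Or.inl hwy
    · exact Or.inr ⟨Finset.mem_univ _, tdist_pos_of_ne hwy, hw.2⟩
  refine (Finset.sum_le_sum_of_subset_of_nonneg hsub fun w _ _ => hf w).trans ?_
  have hui := Finset.sum_union_inter (s₁ := ({y} : Finset (Site P i)))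
    (s₂ := Finset.univ.filter (fun w : Site P i => 1 ≤ Site.tdist w y ∧ Site.tdist w y ≤ t)) (f := f)
  have hint : 0 ≤ ∑ w ∈ ({y} : Finset (Site P i)) ∩ Finset.univ.filter (fun w : Site P i => 1 ≤ Site.tdist w y ∧ Site.tdist w y ≤ t), f w :=
    Finset.sum_nonneg fun w _ => hf w
  rw [Finset.sum_singleton] at hui
  linarith

end Reindex

/-! ## §3 ★★★ The `L¹` junk sum `J₁` -/

section J1

variable (U : Fin P.d → Site P i → (Matrix (Fin N) (Fin N) ℂ)ˣ) (Fr : Site P i → (Matrix (Fin N) (Fin N) ℂ)ˣ)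

/-- ★★★ **THE `L¹` JUNK SUM AT A PIN**: `d = 3`, `m ≥ 3`; `U` unitary, `U`, `Fr` bi-contractive; `Δ_UV = 0` on `{0 < s ≤ 2m}`; framed-link rows `τ₁` on `{s ≤ m+1}` and backward
differences `τ₂` on `{s ≤ m}`; `𝓜 := Σ_{s ≤ 2m+1} hs V`.  Then for the framed field `v = R(Fr⁻¹)V`:
`Σ_{0<s≤m} ‖Δ₁v z‖ ≤ 4τ₁·√(576(m+1))·√(108·𝓜) + 12τ₁·√𝓜 + (36τ₁² + 6τ₂)·√((2(m+2))³)·√𝓜`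
(`≍ τ₁√ℓ·√𝓜 + (τ₂ + τ₁²)ℓ^{3∕2}√𝓜 ≍ eℓM` at the member). [cite: Balaban1985BackgroundPropagators, (3.8) p.392, (3.35) p.396; Giaquinta1984, Ch. III §1] -/
theorem J1_le (hd : P.d = 3) (hUu : ∀ ν x, (U ν x : Matrix (Fin N) (Fin N) ℂ) ∈ unitary (Matrix (Fin N) (Fin N) ℂ))
    (hU : ∀ (κ : Fin P.d) (w : Site P i), ‖(U κ w : Matrix (Fin N) (Fin N) ℂ)‖ ≤ 1 ∧ ‖(((U κ w)⁻¹ : (Matrix (Fin N) (Fin N) ℂ)ˣ) : Matrix (Fin N) (Fin N) ℂ)‖ ≤ 1)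
    (hFr : ∀ z, ‖(Fr z : Matrix (Fin N) (Fin N) ℂ)‖ ≤ 1 ∧ ‖(((Fr z)⁻¹ : (Matrix (Fin N) (Fin N) ℂ)ˣ) : Matrix (Fin N) (Fin N) ℂ)‖ ≤ 1)
    (V : Site P i → Matrix (Fin N) (Fin N) ℂ) (y : Site P i) {m : ℕ} (hm : 3 ≤ m)
    (hV : ∀ z, 0 < Site.tdist z y → Site.tdist z y ≤ 2 * m → divB (torusT P i) U (fun μ => covD (torusT P i) U μ V) z = 0) {τ₁ τ₂ : ℝ}
    (hτ₁ : ∀ (μ : Fin P.d) (z : Site P i), Site.tdist z y ≤ m + 1 →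
      ‖(((Fr z)⁻¹ * U μ z * Fr (torusT P i μ z) : (Matrix (Fin N) (Fin N) ℂ)ˣ) : Matrix (Fin N) (Fin N) ℂ) - 1‖ ≤ τ₁)
    (hτ₂ : ∀ (μ : Fin P.d) (z : Site P i), Site.tdist z y ≤ m →
      ‖(((Fr z)⁻¹ * U μ z * Fr (torusT P i μ z) : (Matrix (Fin N) (Fin N) ℂ)ˣ) : Matrix (Fin N) (Fin N) ℂ)
        - (((Fr (z.unshift μ))⁻¹ * U μ (z.unshift μ) * Fr (torusT P i μ (z.unshift μ)) : (Matrix (Fin N) (Fin N) ℂ)ˣ) : Matrix (Fin N) (Fin N) ℂ)‖ ≤ τ₂) :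
    ∑ z ∈ Finset.univ.filter (fun z : Site P i => 1 ≤ Site.tdist z y ∧ Site.tdist z y ≤ m), ‖laplace 1 (fun w => R (Fr w)⁻¹ (V w)) z‖
      ≤ 4 * τ₁ * (Real.sqrt (576 * ((m + 1 : ℕ) : ℝ))
              * Real.sqrt (36 * P.d * ∑ z ∈ Finset.univ.filter (fun z : Site P i => Site.tdist z y ≤ 2 * m + 1), ∑ j : Fin N, ∑ k : Fin N, ‖(V z) j k‖ ^ 2))
        + 12 * τ₁ * Real.sqrt (∑ z ∈ Finset.univ.filter (fun z : Site P i => Site.tdist z y ≤ 2 * m + 1), ∑ j : Fin N, ∑ k : Fin N, ‖(V z) j k‖ ^ 2)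
        + (36 * τ₁ ^ 2 + 6 * τ₂) * (Real.sqrt ((2 * (((m + 1 : ℕ) : ℝ) + 1)) ^ 3)
              * Real.sqrt (∑ z ∈ Finset.univ.filter (fun z : Site P i => Site.tdist z y ≤ 2 * m + 1), ∑ j : Fin N, ∑ k : Fin N, ‖(V z) j k‖ ^ 2)) := by
  classical
  -- names
  set B := Finset.univ.filter (fun z : Site P i => 1 ≤ Site.tdist z y ∧ Site.tdist z y ≤ m) with hBdef
  set Mass := ∑ z ∈ Finset.univ.filter (fun z : Site P i => Site.tdist z y ≤ 2 * m + 1), ∑ j : Fin N, ∑ k : Fin N, ‖(V z) j k‖ ^ 2 with hMass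
  set q := Real.sqrt Mass with hq
  set DL := Real.sqrt (576 * ((m + 1 : ℕ) : ℝ)) * Real.sqrt (36 * P.d * Mass) with hDL
  set Bm := Real.sqrt ((2 * (((m + 1 : ℕ) : ℝ) + 1)) ^ 3) * q with hBm
  have hτ₁0 : 0 ≤ τ₁ := (norm_nonneg _).trans (hτ₁ ⟨0, P.hd⟩ y (by rw [tdist_self]; omega))
  have hτ₂0 : 0 ≤ τ₂ := by
    obtain ⟨z, hz⟩ : ∃ z : Site P i, Site.tdist z y ≤ m := ⟨y, by rw [tdist_self]; omega⟩
    exact (norm_nonneg _).trans (hτ₂ ⟨0, P.hd⟩ z hz)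
  have hq0 : 0 ≤ q := Real.sqrt_nonneg _
  have hDL0 : 0 ≤ DL := by positivity
  have hBm0 : 0 ≤ Bm := by positivity
  -- pointwise: `‖Δ₁v z‖ ≤ Φ z` on `B`
  have hΦ : ∀ z ∈ B, ‖laplace 1 (fun w => R (Fr w)⁻¹ (V w)) z‖
      ≤ ∑ μ : Fin P.d, (2 * τ₁ * (‖covD (torusT P i) U μ V z‖ + ‖covD (torusT P i) U μ V (z.unshift μ)‖ + 2 * τ₁ * (‖V (z.shift μ)‖ + ‖V z‖))
          + (2 * τ₂ + 4 * τ₁ ^ 2) * ‖V (z.unshift μ)‖) := by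
    intro z hz
    rw [hBdef, Finset.mem_filter] at hz
    refine norm_laplace_one_framed_le U Fr hU hFr V z (hV z (by omega) (by omega)) (fun μ => hτ₁ μ z (by omega))
      (fun μ => hτ₁ μ _ (by have := tdist_unshift_le_succ z y μ; omega)) (fun μ => hτ₂ μ z hz.2.2)
  -- the pieces, summed
  have hmass_pt : ∀ w, Site.tdist w y ≤ 2 * m + 1 → ‖V w‖ ≤ q := fun w hw => norm_le_sqrt_mass V y (2 * m + 1) w hw
  -- (a) `Σ_B Σ_μ ‖DV z μ‖ ≤ DL`
  have hA : ∑ z ∈ B, ∑ μ : Fin P.d, ‖covD (torusT P i) U μ V z‖ ≤ DL := by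
    have h := sum_punctured_norm_covD_le' hd hUu V y (R := m - 1) (by omega)
      (fun z hz0 hz1 => hV z hz0 (by omega))
    have e1 : m - 1 + 2 = m + 1 := by omega
    have e2 : 2 * (m - 1) + 3 = 2 * m + 1 := by omega
    rw [e1, e2] at h
    refine le_trans ?_ h
    refine Finset.sum_le_sum_of_subset_of_nonneg (fun z hz => ?_) fun _ _ _ => Finset.sum_nonneg fun _ _ => norm_nonneg _
    rw [hBdef, Finset.mem_filter] at hz; rw [Finset.mem_filter]; exact ⟨hz.1, hz.2.1, by omega⟩
  -- (b) `Σ_B Σ_μ ‖DV (z−e_μ) μ‖ ≤ 6q + DL`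
  have hB' : ∑ z ∈ B, ∑ μ : Fin P.d, ‖covD (torusT P i) U μ V (z.unshift μ)‖ ≤ 6 * q + DL := by
    rw [Finset.sum_comm]
    have hμ : ∀ μ : Fin P.d, ∑ z ∈ B, ‖covD (torusT P i) U μ V (z.unshift μ)‖
        ≤ 2 * q + ∑ w ∈ Finset.univ.filter (fun w : Site P i => 1 ≤ Site.tdist w y ∧ Site.tdist w y ≤ m + 1), ‖covD (torusT P i) U μ V w‖ := by
      intro μ
      refine (sum_unshift_le y m μ (fun w => ‖covD (torusT P i) U μ V w‖) fun _ => norm_nonneg _).trans ?_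
      refine (sum_ball_le_centre_add y (m + 1) (fun w => ‖covD (torusT P i) U μ V w‖) fun _ => norm_nonneg _).trans ?_
      have hy : ‖covD (torusT P i) U μ V y‖ ≤ 2 * q := by
        refine (norm_covD_le_add hU V μ y).trans ?_
        have h1 := hmass_pt (y.shift μ) (by have := tdist_shift_le_succ y y μ; rw [tdist_self] at this; omega)
        have h2 := hmass_pt y (by rw [tdist_self]; omega)
        linarith
      linarith
    have hsum : ∑ μ : Fin P.d, ∑ z ∈ B, ‖covD (torusT P i) U μ V (z.unshift μ)‖
        ≤ ∑ μ : Fin P.d, (2 * q) + ∑ μ : Fin P.d, ∑ w ∈ Finset.univ.filter (fun w : Site P i => 1 ≤ Site.tdist w y ∧ Site.tdist w y ≤ m + 1), ‖covD (torusT P i) U μ V w‖ := by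
      rw [← Finset.sum_add_distrib]; exact Finset.sum_le_sum fun μ _ => hμ μ
    have hconst : ∑ _μ : Fin P.d, (2 * q) = 6 * q := by
      rw [Finset.sum_const, Finset.card_univ, Fintype.card_fin, nsmul_eq_mul, hd]; push_cast; ring
    have h := sum_punctured_norm_covD_le' hd hUu V y (R := m - 1) (by omega) (fun z hz0 hz1 => hV z hz0 (by omega))
    have e1 : m - 1 + 2 = m + 1 := by omega
    have e2 : 2 * (m - 1) + 3 = 2 * m + 1 := by omega
    rw [e1, e2, Finset.sum_comm] at h
    linarith
  -- (c) `Σ_B ‖V (z+e_μ)‖, Σ_B ‖V z‖, Σ_B ‖V (z−e_μ)‖ ≤ Bm` each (per `μ`)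
  have hball : ∑ w ∈ Finset.univ.filter (fun w : Site P i => Site.tdist w y ≤ m + 1), ‖V w‖ ≤ Bm := by
    have h := sum_norm_le_sqrt_card_mass hd V y (t := m + 1) (t' := 2 * m + 1) (by omega)
    rw [hBm, hq, hMass]; push_cast at h ⊢; exact h
  have hVs : ∀ μ : Fin P.d, ∑ z ∈ B, ‖V (z.shift μ)‖ ≤ Bm := fun μ => (sum_shift_le y m μ (fun w => ‖V w‖) fun _ => norm_nonneg _).trans hball
  have hVu : ∀ μ : Fin P.d, ∑ z ∈ B, ‖V (z.unshift μ)‖ ≤ Bm := fun μ => (sum_unshift_le y m μ (fun w => ‖V w‖) fun _ => norm_nonneg _).trans hball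
  have hV0 : ∑ z ∈ B, ‖V z‖ ≤ Bm := (sum_punctured_le_ball y m (fun w => ‖V w‖) fun _ => norm_nonneg _).trans hball
  -- assemble (keep the `z`-outer order; pull constants out of the sums)
  have hsumΦ : ∑ z ∈ B, ‖laplace 1 (fun w => R (Fr w)⁻¹ (V w)) z‖
      ≤ 2 * τ₁ * (∑ z ∈ B, ∑ μ : Fin P.d, ‖covD (torusT P i) U μ V z‖ + ∑ z ∈ B, ∑ μ : Fin P.d, ‖covD (torusT P i) U μ V (z.unshift μ)‖
            + 2 * τ₁ * (∑ z ∈ B, ∑ μ : Fin P.d, ‖V (z.shift μ)‖ + ∑ z ∈ B, ∑ _μ : Fin P.d, ‖V z‖))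
        + (2 * τ₂ + 4 * τ₁ ^ 2) * ∑ z ∈ B, ∑ μ : Fin P.d, ‖V (z.unshift μ)‖ := by
    refine (Finset.sum_le_sum hΦ).trans (le_of_eq ?_)
    simp only [Finset.sum_add_distrib, ← Finset.mul_sum]
  have h3 : ∑ z ∈ B, ∑ μ : Fin P.d, ‖V (z.shift μ)‖ ≤ 3 * Bm := by
    rw [Finset.sum_comm]
    calc ∑ μ : Fin P.d, ∑ z ∈ B, ‖V (z.shift μ)‖ ≤ ∑ _μ : Fin P.d, Bm := Finset.sum_le_sum fun μ _ => hVs μ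
      _ = 3 * Bm := by rw [Finset.sum_const, Finset.card_univ, Fintype.card_fin, nsmul_eq_mul, hd]; push_cast; ring
  have h4 : ∑ z ∈ B, ∑ _μ : Fin P.d, ‖V z‖ ≤ 3 * Bm := by
    rw [Finset.sum_comm]
    calc ∑ _μ : Fin P.d, ∑ z ∈ B, ‖V z‖ ≤ ∑ _μ : Fin P.d, Bm := Finset.sum_le_sum fun μ _ => hV0
      _ = 3 * Bm := by rw [Finset.sum_const, Finset.card_univ, Fintype.card_fin, nsmul_eq_mul, hd]; push_cast; ring
  have h5 : ∑ z ∈ B, ∑ μ : Fin P.d, ‖V (z.unshift μ)‖ ≤ 3 * Bm := by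
    rw [Finset.sum_comm]
    calc ∑ μ : Fin P.d, ∑ z ∈ B, ‖V (z.unshift μ)‖ ≤ ∑ _μ : Fin P.d, Bm := Finset.sum_le_sum fun μ _ => hVu μ
      _ = 3 * Bm := by rw [Finset.sum_const, Finset.card_univ, Fintype.card_fin, nsmul_eq_mul, hd]; push_cast; ring
  have hc : 0 ≤ 2 * τ₂ + 4 * τ₁ ^ 2 := by positivity
  calc _ ≤ _ := hsumΦ
    _ ≤ 2 * τ₁ * (DL + (6 * q + DL) + 2 * τ₁ * (3 * Bm + 3 * Bm)) + (2 * τ₂ + 4 * τ₁ ^ 2) * (3 * Bm) := by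
        gcongr
    _ = 4 * τ₁ * DL + 12 * τ₁ * q + (36 * τ₁ ^ 2 + 6 * τ₂) * Bm := by ring
    _ = _ := by rw [hDL, hBm, hq]

end J1

end Summit.QuantumFields.YangMills.Theorems.Prop7CovPinJunkPhi

end
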